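import Mathlib
import Summits.Ventures.PercRepro2.ThreePointConn

/-!
# Two-cluster BK: connections in two different clusters are negatively correlated on decreasing events (PercRepro2, mine-1)

On `{x ↮ y}` the open witnesses of `x ↔ a` and `y ↔ b` lie in the two different clusters, so they are
edge-disjoint (`dOcc_of_not_carries`), and the BK inequality restricted to a decreasing event
(`reimer_decreasing` in its weighted form `bk_union_decr_weighted`) becomes a genuine two-cluster
statement (MINE-1.md §17.14, INBOX 2026-08-23T02:1xZ for the crux's certificate menu):

  `two_cluster_bk`:  for every decreasing `D ⊆ {x ↮ y}` and vertices `a`, `b`,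
    `P(x ↔ a, y ↔ b, D) ≤ P(x ↔ a, D) · P(y ↔ b)`,

e.g. `D = PD = {a_l ↮ a_h, a₃ ∉ C(a_l) ∪ C(a_h)}`, `x = a_l`, `y = a_h`, `a = o`, `b = b`:
`P(PD, o ∈ C_l, b ∈ C_h) ≤ P(PD, o ∈ C_l) · P(b ↔ a_h)`.  The bound is for every product measure.
-/

namespace Summit.Ventures.PercRepro2

open ReimerCube

section Disjointness

variable {V : Type*} {E : Type*} [DecidableEq E]

/-- If `x ↮ y` in `S`, the `x`-component and the `y`-component of `S` are disjoint. -/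
lemma disjoint_sComp_of_not_carries {ends : E → Sym2 V} {S : Finset E} {x y : V}
    (h : ¬ Carries ends S x y) : Disjoint (sComp ends S x) (sComp ends S y) := by
  rw [Finset.disjoint_left]
  intro e hex hey
  -- both endpoints of `e` are reachable from `x` and from `y`
  obtain ⟨z, hz⟩ : ∃ z, z ∈ ends e := by
    induction (ends e) using Sym2.ind with
    | _ u v => exact ⟨u, Sym2.mem_mk_left u v⟩
  have hxz : Carries ends S x z := carries_of_mem_sComp hex hz
  have hyz : Carries ends S y z := carries_of_mem_sComp hey hz
  exact h (conn_trans hxz (conn_symm hyz))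

/-- **Different clusters give disjoint witnesses**: if `S` carries `x–a` and `y–b` but not `x–y`, then
`S` carries edge-disjoint witnesses of `x ↔ a` and `y ↔ b`. -/
lemma dOcc_of_not_carries {ends : E → Sym2 V} {S : Finset E} {x y a b : V}
    (hxy : ¬ Carries ends S x y) (hxa : Carries ends S x a) (hyb : Carries ends S y b) :
    DOcc (fun T => Carries ends T x a) (fun T => Carries ends T y b) S :=
  ⟨sComp ends S x, sComp ends S y, sComp_subset ends S x, sComp_subset ends S y,
    disjoint_sComp_of_not_carries hxy,
    fun _ hT => Carries.mono hT (carries_sComp hxa),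
    fun _ hT => Carries.mono hT (carries_sComp hyb)⟩

end Disjointness

section TwoCluster

variable {V : Type*} {E : Type*} [Fintype E] [DecidableEq E]

open Classical in
/-- **Two-cluster BK inequality.**  For a decreasing event `D ⊆ {x ↮ y}` (as a predicate on the set
of open edges) and vertices `a`, `b`, for every product measure:
`P(x ↔ a, y ↔ b, D) ≤ P(x ↔ a, D) · P(y ↔ b)`. -/
theorem two_cluster_bk (p : E → ℝ) (hp : IsProbVec p) (ends : E → Sym2 V) (x y a b : V)
    (D : Finset E → Prop) (hD : Decr D) (hDQ : ∀ S, D S → ¬ Carries ends S x y) :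
    (∑ S ∈ Finset.univ.powerset.filter
        (fun S => Carries ends S x a ∧ Carries ends S y b ∧ D S), wt Finset.univ p S)
      ≤ (∑ S ∈ Finset.univ.powerset.filter (fun S => Carries ends S x a ∧ D S), wt Finset.univ p S)
          * (∑ S ∈ Finset.univ.powerset.filter (fun S => Carries ends S y b), wt Finset.univ p S) := by
  have hp' : ∀ i, 0 ≤ p i ∧ p i ≤ 1 := fun i => ⟨hp.nonneg i, hp.le_one i⟩
  have hX := incr_carries ends x a
  have hY := incr_carries ends y b
  have h := bk_union_decr_weighted Finset.univ p hp' (fun S => Carries ends S x a)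
    (fun S => Carries ends S x a) (fun S => Carries ends S y b) (fun S => Carries ends S y b) D
    hX hX hY hY hD (fun _ h => h) (fun _ h => h)
  rw [sum_wt, mul_one] at h
  -- the left side is dominated by the BK-restricted sum
  have hL : (∑ S ∈ Finset.univ.powerset.filter
        (fun S => Carries ends S x a ∧ Carries ends S y b ∧ D S), wt Finset.univ p S)
      ≤ ∑ S ∈ Finset.univ.powerset.filter
          (fun S => (DOcc (fun T => Carries ends T x a) (fun T => Carries ends T y b) S ∨
            DOcc (fun T => Carries ends T x a) (fun T => Carries ends T y b) S) ∧ D S),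
          wt Finset.univ p S := by
    apply Finset.sum_le_sum_of_subset_of_nonneg
    · intro S hS
      rw [Finset.mem_filter] at hS ⊢
      obtain ⟨hS1, hxa, hyb, hDS⟩ := hS
      exact ⟨hS1, Or.inl (dOcc_of_not_carries (hDQ S hDS) hxa hyb), hDS⟩
    · intro S _ _
      exact wt_nonneg Finset.univ p hp' S
  refine hL.trans (h.trans (le_of_eq ?_))
  rw [Finset.sum_mul_sum, ← Finset.sum_product']
  apply Finset.sum_congr
  · ext q
    simp only [Finset.mem_filter, Finset.mem_product, or_self]
    tauto
  · intros; rfl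

open Classical in
/-- The two-cluster BK inequality in typer-1's `prob` vocabulary, for a decreasing event `D` of
configurations contained in `{x ↮ y}`:
`prob p ({x↔a} ∩ {y↔b} ∩ D) ≤ prob p ({x↔a} ∩ D) · prob p {y↔b}`. -/
theorem two_cluster_bk_prob (p : E → ℝ) (hp : IsProbVec p) (ends : E → Sym2 V) (x y a b : V)
    (D : Set (Config E)) (hD : IsLowerSet D) (hDQ : ∀ ω ∈ D, ¬ Conn ends ω x y) :
    prob p (connEvent ends x a ∩ connEvent ends y b ∩ D)
      ≤ prob p (connEvent ends x a ∩ D) * prob p (connEvent ends y b) := by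
  have hDf : Decr (fun S : Finset E => ofFinset S ∈ D) := by
    intro S T hST hT
    exact hD (ofFinset_mono hST) hT
  have hDQf : ∀ S : Finset E, ofFinset S ∈ D → ¬ Carries ends S x y :=
    fun S hS => hDQ _ hS
  have h := two_cluster_bk p hp ends x y a b (fun S => ofFinset S ∈ D) hDf hDQf
  rw [prob_eq_sum_wt, prob_eq_sum_wt, prob_eq_sum_wt]
  refine le_trans (le_of_eq ?_) (h.trans (le_of_eq ?_))
  · exact sum_filter_congr_pred fun _ =>
      ⟨fun ⟨⟨h1, h2⟩, h3⟩ => ⟨h1, h2, h3⟩, fun ⟨h1, h2, h3⟩ => ⟨⟨h1, h2⟩, h3⟩⟩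
  · exact congrArg₂ (· * ·) (sum_filter_congr_pred fun _ => Iff.rfl)
      (sum_filter_congr_pred fun _ => Iff.rfl)

end TwoCluster

end Summit.Ventures.PercRepro2
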